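import Literature.AlgebraicGeometry.Resolution.ArithmeticalThreefoldsLocalRankReduction
import HarnessLib

/-!
# Cossart–Piltant 2019, Prop. 4.10: the rank-one reduction (C5), keyed on an abstract dimension-two model lemma

Topic: `Literature/AlgebraicGeometry/Resolution` (proofs only: no new notions, no new named facts).

`ArithmeticalThreefoldsLocalRankReduction.lean` proves the reduction of local uniformization in Cossart–Piltant's
climbing frame to RANK-ONE valuations (hypothesis (C5) of `cossartPiltant2019ReductionP_of_parts`) from resolution
of excellent surfaces in the NON-embedded form `CossartJannsenSaito2020General`, which enters only through the
model lemma `exists_model_regular_of_cjs` (a finitely generated model whose local ring at the centre has dimension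
`≤ 2` can be enlarged to one that is regular at the centre).  This file repeats the three downstream steps with that
lemma as an explicit HYPOTHESIS `hLU2` (stated over the base ring `S`, for every field, valuation ring and model):

* `exists_residueModel_regular_of_lu2` — the residue-side model of `ν₂` (Novacoski–Spivakovsky Cor. 2.17 input);
* `exists_model_regular_of_lt_of_lu2` — regular models for composite valuations (NS §3.1);
* `rankOne_reduction_of_lu2` — (C5) from `hLU2`.

So (C5) follows from ANY source of the dimension-two model lemma — in particular from the EMBEDDED theorem CJS
Thm. 1.4 (`B = ∅`) over a regular excellent base (`exists_model_regular_of_cjsEmbedded`,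
`ArithmeticalThreefoldsLocalRankReductionEmbedded.lean`), which is how the `CleanModels` crux of the summit
`ResolutionOfSingularities` keys Cossart–Piltant's Prop. 4.10 on its stub 1.  Proofs are those of the original file
verbatim, with the model lemma abstracted.

## Sources

* V. Cossart, O. Piltant, *Resolution of singularities of arithmetical threefolds*, J. Algebra 529 (2019),
  proof of Prop. 4.10 (arXiv v1: Prop. 4.8, p. 53). [CossartPiltant2019]
* J. Novacoski, M. Spivakovsky, *Reduction of local uniformization to the rank one case* (2014), Thm. 1.1,
  Cor. 2.14, Cor. 2.17, §3.1. [NovacoskiSpivakovsky2014]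
-/

noncomputable section

open CategoryTheory AlgebraicGeometry IsLocalRing Polynomial

namespace Literature.AlgebraicGeometry.Resolution

universe u

/-! ## The residue side -/

section Residue

variable {S K : Type u} [CommRing S] [Field K] [Algebra S K]

/-- **Local uniformization of `ν₂` above the residue model** — the input `h₂` of
`novacoskiSpivakovsky2014_cor217`, discharged by resolution of excellent surfaces: with `A ⊆ O ≤ O₁` a finitely
generated model over the excellent ring `S`, `Q ⊇ P` the centres, `φ : A → κ ⊆ κ(O₁)` the
residue map (so `φ(A) ≅ A/P`, an excellent domain), and `ht (Q/P) ≤ 2`, the local ring of `φ(A)`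
at the centre of `ν₂` has dimension `≤ 2`, and the abstract model lemma `hLU2` gives
a regular finitely generated model `B ⊇ φ(A)` of `ν₂` restricted to `κ = Frac φ(A)`.
[cite: CossartJannsenSaito2020, Thm. 1.2] [cite: NovacoskiSpivakovsky2014, Cor. 2.17] -/
theorem exists_residueModel_regular_of_lu2 (hLU2 : ∀ (K : Type u) [Field K] [Algebra S K] (O' : ValuationSubring K) (R : Subalgebra S K),
      R.FG → ∀ [IsNoetherianRing R] [IsFractionRing R K], R.toSubring ≤ O'.toSubring →
      ∀ (P' : Ideal R) [P'.IsPrime], (∀ z : R, z ∈ P' ↔ O'.valuation (z : K) < 1) →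
      ringKrullDim (Localization.AtPrime P') ≤ 2 →
      ∃ (A₁ : Subalgebra S K) (hA₁ : A₁.toSubring ≤ O'.toSubring), R ≤ A₁ ∧ A₁.FG ∧
        IsRegularLocalRing (Localization.AtPrime ((maximalIdeal O').comap (Subring.inclusion hA₁))))
    (hS : IsExcellentRing S) (O O₁ : ValuationSubring K) (hO : O ≤ O₁) (A : Subalgebra S K)
    (hA : A.toSubring ≤ O.toSubring) (hAfg : A.FG) (Q P : Ideal A) [Q.IsPrime] [P.IsPrime]
    (hQ : ∀ z : A, z ∈ Q ↔ O.valuation (z : K) < 1)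
    (hP : ∀ z : A, z ∈ P ↔ O₁.valuation (z : K) < 1) (hPQ : P ≤ Q)
    (hdimQP : (Q.map (Ideal.Quotient.mk P)).height ≤ 2)
    (κ : Type u) [Field κ] [Algebra S κ] (ι : κ →+* ResidueField O₁) (φ : A →ₐ[S] κ)
    (hφ : ∀ a : A, ι (φ a) = residue O₁ ⟨(a : K), (hA.trans hO) a.2⟩)
    (hfr : IsFractionRing φ.range κ) :
    ∃ (B : Subalgebra S κ)
      (hB : B.toSubring ≤ ((residueValuationSubring O O₁ hO).comap ι).toSubring),
      φ.range ≤ B ∧ B.FG ∧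
      IsRegularLocalRing (Localization.AtPrime
        ((maximalIdeal ((residueValuationSubring O O₁ hO).comap ι)).comap
          (Subring.inclusion hB))) := by
  classical
  haveI : IsNoetherianRing S := hS.isUniversallyCatenaryRing.1
  let O₂ := residueValuationSubring O O₁ hO
  let O₂' := O₂.comap ι
  have hO₂' : ∀ y : κ, O₂'.valuation y < 1 ↔ O₂.valuation (ι y) < 1 := fun y =>
    valuation_comap_lt_one_iff O₂ ι y
  let B₀ : Subalgebra S κ := φ.range
  have hB₀fg : B₀.FG := by
    have h := ((Subalgebra.fg_top A).mpr hAfg).map φ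
    rwa [Algebra.map_top] at h
  haveI : IsNoetherianRing B₀ := isNoetherianRing_of_fg hB₀fg
  haveI : Algebra.FiniteType S B₀ := (Subalgebra.fg_iff_finiteType _).mp hB₀fg
  haveI : IsFractionRing B₀ κ := hfr
  have hB₀O : B₀.toSubring ≤ O₂'.toSubring := by
    intro z hz
    obtain ⟨a, rfl⟩ := (AlgHom.mem_range φ).mp (show z ∈ φ.range from hz)
    change φ a ∈ O₂.comap ι
    rw [ValuationSubring.mem_comap, hφ]
    exact (residue_mem_residueValuationSubring_iff O O₁ hO _).mpr (hA a.2)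
  let 𝔮 : Ideal B₀ := (maximalIdeal O₂').comap (Subring.inclusion hB₀O)
  haveI : 𝔮.IsPrime := Ideal.IsPrime.comap _
  have h𝔮 : ∀ z : B₀, z ∈ 𝔮 ↔ O₂'.valuation (z : κ) < 1 := fun z => by
    rw [Ideal.mem_comap, ValuationSubring.valuation_lt_one_iff]; rfl
  -- `φ(A) ≅ A / P`, carrying the centre of `ν₂` to `Q / P`
  let ψ : A →ₐ[S] B₀ := φ.rangeRestrict
  have hψ : Function.Surjective ψ := AlgHom.rangeRestrict_surjective φ
  have hψval : ∀ a : A, ((ψ a : B₀) : κ) = φ a := fun a => rfl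
  have hker : RingHom.ker ψ.toRingHom = P := by
    ext a
    rw [RingHom.mem_ker, hP]
    change ψ a = 0 ↔ _
    rw [Subtype.ext_iff, hψval, ZeroMemClass.coe_zero, ← map_eq_zero_iff ι ι.injective, hφ,
      residue_eq_zero_iff, ValuationSubring.valuation_lt_one_iff]
  have hψ' : Function.Surjective ψ.toRingHom := hψ
  let e : (A ⧸ P) ≃+* B₀ :=
    (Ideal.quotEquivOfEq hker.symm).trans (RingHom.quotientKerEquivOfSurjective hψ')
  have he : ∀ a : A, e (Ideal.Quotient.mk P a) = ψ a := fun a => by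
    change (RingHom.quotientKerEquivOfSurjective hψ')
      (Ideal.quotEquivOfEq hker.symm (Ideal.Quotient.mk P a)) = ψ a
    rw [Ideal.quotEquivOfEq_mk, RingHom.quotientKerEquivOfSurjective_apply_mk]
    rfl
  haveI hQ' : (Q.map (Ideal.Quotient.mk P)).IsPrime :=
    Ideal.map_isPrime_of_surjective Ideal.Quotient.mk_surjective (by rwa [Ideal.mk_ker])
  have hcomap : 𝔮.comap e = Q.map (Ideal.Quotient.mk P) := by
    ext z
    obtain ⟨a, rfl⟩ := Ideal.Quotient.mk_surjective z
    rw [Ideal.mem_quotient_iff_mem hPQ, Ideal.mem_comap, hQ]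
    rw [he, h𝔮, hψval, hO₂', hφ, ← valuation_lt_one_iff_residue O O₁ hO (a : K) (hA a.2)]
  have hheight : 𝔮.height = (Q.map (Ideal.Quotient.mk P)).height := by
    rw [← hcomap]; exact (RingEquiv.height_comap e 𝔮).symm
  have hdim𝔮 : ringKrullDim (Localization.AtPrime 𝔮) ≤ 2 := by
    rw [IsLocalization.AtPrime.ringKrullDim_eq_height 𝔮 (Localization.AtPrime 𝔮), hheight]
    exact WithBot.coe_le_coe.mpr hdimQP
  exact hLU2 κ O₂' B₀ hB₀fg hB₀O 𝔮 h𝔮 hdim𝔮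

end Residue

/-! ## The three steps over the base `S` -/

section Core

variable {S K : Type u} [CommRing S] [IsDomain S] [IsLocalRing S]
  [Field K] [Algebra S K] [FaithfulSMul S K] [Algebra.IsAlgebraic S K]

/-- **Regular models for composite valuations in dimension three** (Cossart–Piltant 2019,
proof of Prop. 4.10, "it can be assumed that `v` has rank one … transcendental residue
extensions provide a reduction in `dim A` after blowing up", via Novacoski–Spivakovsky's §3.1
with both inputs supplied by resolution of excellent surfaces). Let `S` be an excellent local
domain of dimension three, `K ⊇ S` algebraic, `O < O₁ < K` valuation rings with `O`
dominating `S` and residue field algebraic over that of `S`, and `R ⊆ O` a finitely generated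
model with `Frac R = K`. Then some finitely generated `A ⊇ R` inside `O` is regular at the
centre of `O`: adjoin `x ∈ 𝔪_O ∖ 𝔪_{O₁}`; `dims_of_separating_model` bounds the two
dimensions by `2`; the abstract model lemma `hLU2` uniformizes `ν₁ = ν_{O₁}` (Cor. 2.14,
`novacoskiSpivakovsky2014_cor214`), `exists_residueModel_regular_of_lu2` uniformizes `ν₂` above the residue
model (Cor. 2.17, `novacoskiSpivakovsky2014_cor217`), and the final blowing up of §3.1 (`novacoskiSpivakovsky2014_step`)
concludes. [cite: CossartPiltant2019, proof of Prop. 4.10 (arXiv v1: Prop. 4.8, p. 53)]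
[cite: NovacoskiSpivakovsky2014, §3.1] [cite: CossartJannsenSaito2020, Thm. 1.2] -/
theorem exists_model_regular_of_lt_of_lu2 (hLU2 : ∀ (K : Type u) [Field K] [Algebra S K] (O' : ValuationSubring K) (R : Subalgebra S K),
      R.FG → ∀ [IsNoetherianRing R] [IsFractionRing R K], R.toSubring ≤ O'.toSubring →
      ∀ (P' : Ideal R) [P'.IsPrime], (∀ z : R, z ∈ P' ↔ O'.valuation (z : K) < 1) →
      ringKrullDim (Localization.AtPrime P') ≤ 2 →
      ∃ (A₁ : Subalgebra S K) (hA₁ : A₁.toSubring ≤ O'.toSubring), R ≤ A₁ ∧ A₁.FG ∧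
        IsRegularLocalRing (Localization.AtPrime ((maximalIdeal O').comap (Subring.inclusion hA₁))))
    (hS : IsExcellentRing S) (hSdim : ringKrullDim S = 3)
    (O O₁ : ValuationSubring K) (hO : O ≤ O₁) (hne : O ≠ O₁) (hO₁ : O₁ ≠ ⊤)
    (hSO : ∀ s : S, algebraMap S K s ∈ O)
    (hdom : ∀ s ∈ maximalIdeal S, O.valuation (algebraMap S K s) < 1)
    (hres : ∀ y : O, ∃ q : S[X], (∃ i, q.coeff i ∉ maximalIdeal S) ∧
      O.valuation (q.eval₂ (algebraMap S K) y) < 1)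
    (R : Subalgebra S K) (hRfg : R.FG) [hRfrac : IsFractionRing R K]
    (hRO : R.toSubring ≤ O.toSubring) :
    ∃ (A : Subalgebra S K) (hA : A.toSubring ≤ O.toSubring), R ≤ A ∧ A.FG ∧
      IsRegularLocalRing (Localization.AtPrime ((maximalIdeal O).comap (Subring.inclusion hA))) := by
  classical
  haveI : IsNoetherianRing S := hS.isUniversallyCatenaryRing.1
  -- an element `x ∈ 𝔪_O ∖ 𝔪_{O₁}`
  obtain ⟨y, hyO₁, hyO⟩ : ∃ y : K, y ∈ O₁ ∧ y ∉ O := by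
    by_contra h
    push Not at h
    exact hne (le_antisymm hO fun z hz => h z hz)
  have hy0 : y ≠ 0 := fun h0 => hyO (by rw [h0]; exact O.zero_mem)
  set x : K := y⁻¹ with hxdef
  have hx0 : x ≠ 0 := inv_ne_zero hy0
  have hxO : x ∈ O := (O.mem_or_inv_mem y).resolve_left hyO
  have hxv : O.valuation x < 1 := by
    change O.valuation ((⟨x, hxO⟩ : O) : K) < 1
    rw [← ValuationSubring.valuation_lt_one_iff, mem_maximalIdeal, mem_nonunits_iff]
    intro hu
    apply hyO
    have := inv_mem_of_isUnit O hxO hu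
    rwa [hxdef, inv_inv] at this
  have hxv₁ : O₁.valuation x = 1 := by
    apply le_antisymm ((O₁.valuation_le_one_iff x).mpr (hO hxO))
    have h := (O₁.valuation_le_one_iff x⁻¹).mpr (by rw [hxdef, inv_inv]; exact hyO₁)
    rwa [map_inv₀, inv_le_one₀ ((Valuation.pos_iff _).mpr hx0)] at h
  -- the model `R' = R[x]`
  let R' : Subalgebra S K := R ⊔ Algebra.adjoin S {x}
  have hRR' : R ≤ R' := le_sup_left
  have hR'fg : R'.FG := hRfg.sup ⟨{x}, by rw [Finset.coe_singleton]⟩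
  have hR'O : R'.toSubring ≤ O.toSubring := by
    have : R' ≤ ({ O.toSubring with algebraMap_mem' := hSO } : Subalgebra S K) :=
      sup_le (fun z hz => hRO hz) (Algebra.adjoin_le (Set.singleton_subset_iff.mpr hxO))
    exact fun z hz => this hz
  have hR'O₁ : R'.toSubring ≤ O₁.toSubring := hR'O.trans hO
  haveI : IsFractionRing R.toSubring K := hRfrac
  haveI hR'frac : IsFractionRing R'.toSubring K := isFractionRing_subalgebra_of_le R R' hRR'
  haveI hR'frac' : IsFractionRing R' K := hR'frac
  have hxR' : x ∈ R' :=
    (le_sup_right : Algebra.adjoin S {x} ≤ R') (Algebra.subset_adjoin (Set.mem_singleton x))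
  haveI : IsNoetherianRing R' := isNoetherianRing_of_fg hR'fg
  haveI : Algebra.FiniteType S R' := (Subalgebra.fg_iff_finiteType _).mp hR'fg
  -- the centres on `R'`
  let Q : Ideal R' := (maximalIdeal O).comap (Subring.inclusion hR'O)
  let P : Ideal R' := (maximalIdeal O₁).comap (Subring.inclusion hR'O₁)
  haveI : Q.IsPrime := Ideal.IsPrime.comap _
  haveI : P.IsPrime := Ideal.IsPrime.comap _
  have hQ : ∀ z : R', z ∈ Q ↔ O.valuation (z : K) < 1 := fun z => by
    rw [Ideal.mem_comap, ValuationSubring.valuation_lt_one_iff]; rfl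
  have hP : ∀ z : R', z ∈ P ↔ O₁.valuation (z : K) < 1 := fun z => by
    rw [Ideal.mem_comap, ValuationSubring.valuation_lt_one_iff]; rfl
  obtain ⟨-, hdimP, -⟩ := dims_of_separating_model hSdim O O₁ hO hO₁ hSO hdom hres R' hR'fg hR'O
    x hxR' hxv hxv₁ Q P hQ hP
  -- Cor. 2.14: a model regular at the centre of `ν₁`
  have h₁ := hLU2 K O₁ R' hR'fg hR'O₁ P hP hdimP
  obtain ⟨A, hA, hR'A, hAfg, hregPA⟩ := novacoskiSpivakovsky2014_cor214 O O₁ hO R' hR'fg hR'frac' hR'O h₁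
  -- Cor. 2.17 on `A`
  haveI hAfrac : IsFractionRing A.toSubring K := isFractionRing_subalgebra_of_le R' A hR'A
  haveI hAfrac' : IsFractionRing A K := hAfrac
  have hAO₁ : A.toSubring ≤ O₁.toSubring := hA.trans hO
  let QA : Ideal A := (maximalIdeal O).comap (Subring.inclusion hA)
  let PA : Ideal A := (maximalIdeal O₁).comap (Subring.inclusion hAO₁)
  haveI : QA.IsPrime := Ideal.IsPrime.comap _
  haveI : PA.IsPrime := Ideal.IsPrime.comap _
  have hQA : ∀ z : A, z ∈ QA ↔ O.valuation (z : K) < 1 := fun z => by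
    rw [Ideal.mem_comap, ValuationSubring.valuation_lt_one_iff]; rfl
  have hPA : ∀ z : A, z ∈ PA ↔ O₁.valuation (z : K) < 1 := fun z => by
    rw [Ideal.mem_comap, ValuationSubring.valuation_lt_one_iff]; rfl
  obtain ⟨hPQA, -, hdimQPA⟩ := dims_of_separating_model hSdim O O₁ hO hO₁ hSO hdom hres A hAfg hA
    x (hR'A hxR') hxv hxv₁ QA PA hQA hPA
  have h₂ := exists_residueModel_regular_of_lu2 hLU2 hS O O₁ hO A hA hAfg QA PA hQA hPA hPQA
    hdimQPA
  obtain ⟨A₂, hA₂, hAA₂, hA₂fg, hregP₂, hregQ₂⟩ :=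
    novacoskiSpivakovsky2014_cor217 O O₁ hO A hA hAfg hAfrac' hregPA h₂
  -- §3.1, final step
  haveI hA₂frac : IsFractionRing A₂.toSubring K :=
    isFractionRing_subalgebra_of_le A A₂ hAA₂
  obtain ⟨A₃, hA₃, hA₂₃, hA₃fg, hreg₃⟩ :=
    novacoskiSpivakovsky2014_step O O₁ hO A₂ hA₂ hA₂fg hA₂frac hregP₂ hregQ₂
  exact ⟨A₃, hA₃, hRR'.trans (hR'A.trans (hAA₂.trans hA₂₃)), hA₃fg, hreg₃⟩

end Core
end Literature.AlgebraicGeometry.Resolution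

end
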